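import Literature.AnabelianGeometry.AbsoluteAnabelian.AbsTopIThm17iiQuotientElasticProofs
import Literature.AnabelianGeometry.AbsoluteAnabelian.FreeProlRankExtensionProofs
import Mathlib.Topology.Algebra.ClopenNhdofOne
import HarnessLib

/-!
# [AbsTopI] Thm 1.7 (ii), quotient clause: almost pro-`Σ`-maximal quotients of `G_k` (`p ∈ Σ`) are SLIM

S. Mochizuki, *Topics in Absolute Anabelian Geometry I: Generalities* (2012) [AbsTopI] (lit key
`paper:url-11ac98ba15fc`), Thm 1.7 (ii) p. 14: "If `k` is an MLF of residue characteristic `p`, then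
`G_k`, as well as any almost pro-`p`-maximal quotient `G_k ↠ Q` of `G_k`, is elastic and slim"; for the
quotients the printed proof reads "the slimness portion of assertion (ii) for `Q` is precisely the content
of Proposition 1.6, (i)" (p. 14), and Prop 1.6 (i) p. 13 ("Any almost pro-`p`-maximal quotient `G_k ↠ Q`
of `G_k` is slim") is proved by "the argument applied to verify Proposition 1.5, (i)", i.e. LOCAL CLASS
FIELD THEORY: for `H ⊴ G_k` open, `G_k/H` acts faithfully on `H^{ab}` via `(𝒪_{k_H}^×) ⊗ ℚ_p ≅ k_H`.

The tree holds the ELASTICITY half of the quotient clause (abc-iut-L4-t15's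
`isElastic_absoluteGaloisGroup_quotient_proSigmaKernel`, `AbsTopIThm17iiQuotientElasticProofs`) and the
slimness of `G_k` itself (abc-iut-L4-d2's reciprocity-free Kummer proof `galoisMLF_slim_holds`).  THIS
PROOF-ONLY FILE (abc-iut-w5-d206; no definitions, no named facts) proves the **SLIMNESS half of the
quotient clause**, with the SAME binders as the elasticity half, by the cell's ELEMENTARY RANK ROUTE —
NOT the printed LCFT route (HONEST CAVEAT: an independent argument for the typed predicate;
establishment = our kernel check):

* `freeProlRank_eq_zero_of_forall_hom_eq_one` — `δ¹_p(M) = 0` when `Hom_cont(M, ℤ_pⁿ) = 1` for all `n`;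
* `mem_of_forall_commutator_mem_of_affine_rankFormula` — CORE: let `Γ` be a compact group whose open
  subgroups satisfy an affine rank formula `δ¹_p(U) = c·[Γ:U] + e` (`c ≥ 1`), `U₀ ⊴ Γ` open, `M ⊆ U₀`
  closed with `δ¹_p(M) = 0`, and `g ∈ Γ` with `g v g⁻¹ v⁻¹ ∈ M` for all `v ∈ U₀`.  Then `g ∈ U₀`: the
  tree's KEY RANK LEMMA (abc-iut-L4-t16/w5-d206, `freeProlRank_le_add_of_sup_zpowers`) gives
  `δ¹_p(U₀) ≤ δ¹_p(U₀·⟨g⟩) + δ¹_p(M) = δ¹_p(U₀·⟨g⟩)`, i.e. `c·[Γ:U₀] + e ≤ c·[Γ:U₀·⟨g⟩] + e`, so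
  `[U₀·⟨g⟩ : U₀] = 1`;
* `isSlimGroup_of_affine_rankFormula` — such a profinite `Γ` is SLIM (`M = 1`; a centraliser element
  `g` of an open `U` lies in every open normal `U₀ ⊆ U`, and these separate points);
* `isSlimGroup_quotient_of_affine_rankFormula` — for `K ⊴ Γ` closed with `Hom_cont(K, ℤ_pⁿ) = 1`, the
  quotient `Γ/K` is SLIM (`M = K`, pulling an open normal subgroup of `Γ/K` back to `Γ`);
* `isSlimGroup_absoluteGaloisGroup_quotient_proSigmaKernel` — **[AbsTopI] Thm 1.7 (ii), quotient
  clause (slimness) = Prop 1.6 (i)** in the tree's vocabulary: for `K/ℚ_p` finite, `N ⊆ G_K` open,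
  `Σ ∋ p`, and `K_Σ ⊆ N` the kernel of the maximal pro-`Σ` quotient of `N` (membership hypothesis),
  normal in `G_K`, the quotient `G_K / K_Σ` is slim — rank formula `δ¹_p(U) = [K:ℚ_p]·[G_K:U] + 1`
  (`freeProlRank_eq_of_isOpen_absoluteGaloisGroup`) and `Hom_cont(K_Σ, ℤ_pⁿ) = 1`
  (`padicIntPi_hom_eq_one`); EVERY case (`μ_p ⊆ k_N` or not; any `Σ ∋ p`; print: `Σ = {p}`);
* `thm17ii_quotient` — the assembled quotient clause: `G_K / K_Σ` is elastic AND slim;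
* `isSlimGroup_absoluteGaloisGroup_of_rankFormula` — a second, rank-route proof that `G_K` itself is
  slim (the tree's proof of record is `galoisMLF_slim_holds`).

Classical profinite group theory; nothing here bears on [IUTchIII] Cor. 3.12.
-/

noncomputable section

open Topology

universe u

namespace Literature.AnabelianGeometry.AbsoluteAnabelian

open Literature.AlgebraicGeometry.Frobenioids (IsSlimGroup)
open Literature.AnabelianGeometry.Anabelioids (IsSigmaInteger)
open Literature.GroupTheory.ProfiniteSubquotients

/-! ### `δ¹_p(M) = 0` for groups all of whose `ℤ_pⁿ`-valued characters are trivial -/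

/-- If every continuous homomorphism `M → ℤ_pⁿ` (all `n`) is trivial, then the free pro-`p` rank
`δ¹_p(M)` — the supremum of the `n` with a continuous surjection `M ↠ ℤ_pⁿ` — is `0`.
[cite: MochizukiAbsTopI2012, Thm 2.6 p.21] -/
theorem freeProlRank_eq_zero_of_forall_hom_eq_one {M : Type u} [Group M] [TopologicalSpace M]
    (p : ℕ) [Fact p.Prime]
    (h : ∀ (n : ℕ) (φ : M →ₜ* Multiplicative (Fin n → ℤ_[p])), ∀ x, φ x = 1) :
    freeProlRank M p = 0 := by
  unfold freeProlRank
  refine le_antisymm (iSup₂_le fun n hn => ?_) bot_le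
  obtain ⟨f, hf⟩ := hn
  cases n with
  | zero => simp
  | succ n =>
    exfalso
    obtain ⟨x, hx⟩ := hf (Multiplicative.ofAdd fun _ => (1 : ℤ_[p]))
    have h1 : (Multiplicative.ofAdd fun _ : Fin (n + 1) => (1 : ℤ_[p])) = 1 := by rw [← hx, h _ f x]
    have h2 := congrArg (fun y : Multiplicative (Fin (n + 1) → ℤ_[p]) => Multiplicative.toAdd y 0) h1
    simp only [toAdd_ofAdd, toAdd_one, Pi.zero_apply] at h2
    exact one_ne_zero h2

/-! ### The core rank argument -/

variable {Γ : Type u} [Group Γ] [TopologicalSpace Γ] [IsTopologicalGroup Γ]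

/-- **Core of the rank route to slimness.**  Let `Γ` be a compact topological group all of whose
open subgroups satisfy the affine rank formula `δ¹_p(U) = c·[Γ:U] + e` with `c ≥ 1`; let `U₀ ⊴ Γ` be
open, `M ⊆ U₀` closed with `δ¹_p(M) = 0`, and `g ∈ Γ` with `g v g⁻¹ v⁻¹ ∈ M` for every `v ∈ U₀`.
Then `g ∈ U₀`.  Indeed `V := U₀·⟨g⟩` is open, `U₀ ⊴ V`, and the key rank lemma
`freeProlRank_le_add_of_sup_zpowers` yields `c·[Γ:U₀] + e ≤ c·[Γ:V] + e + 0`; as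
`[Γ:U₀] = [V:U₀]·[Γ:V]`, this forces `[V:U₀] = 1`. [cite: MochizukiAbsTopI2012, Thm 1.7 (ii) p.14] -/
theorem mem_of_forall_commutator_mem_of_affine_rankFormula [CompactSpace Γ]
    (p c e : ℕ) [Fact p.Prime] (hc : 0 < c)
    (hRF : ∀ U : Subgroup Γ, IsOpen (U : Set Γ) → freeProlRank U p = ((c * U.index + e : ℕ) : ℕ∞))
    (U₀ : Subgroup Γ) [hU₀n : U₀.Normal] (hU₀o : IsOpen (U₀ : Set Γ))
    (M : Subgroup Γ) (hMU₀ : M ≤ U₀) (hMc : IsClosed (M : Set Γ)) (hM0 : freeProlRank M p = 0)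
    (g : Γ) (hcomm : ∀ v ∈ U₀, g * v * g⁻¹ * v⁻¹ ∈ M) : g ∈ U₀ := by
  classical
  by_contra hg
  haveI : Finite (Γ ⧸ U₀) := Subgroup.quotient_finite_of_isOpen U₀ hU₀o
  haveI hU₀fi : U₀.FiniteIndex := Subgroup.finiteIndex_of_finite_quotient
  -- `V := U₀ · ⟨g⟩`
  set V : Subgroup Γ := U₀ ⊔ Subgroup.zpowers g with hV
  have hgV : g ∈ V := Subgroup.mem_sup_right (Subgroup.mem_zpowers g)
  have hU₀V : U₀ ≤ V := le_sup_left
  have hVo : IsOpen (V : Set Γ) := Subgroup.isOpen_mono hU₀V hU₀o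
  haveI : Finite (Γ ⧸ V) := Subgroup.quotient_finite_of_isOpen V hVo
  haveI hVfi : V.FiniteIndex := Subgroup.finiteIndex_of_finite_quotient
  have hU₀n' : (U₀.subgroupOf V).Normal := Subgroup.Normal.subgroupOf hU₀n V
  -- the key rank lemma
  have hkey := freeProlRank_le_add_of_sup_zpowers p V U₀ M g hU₀o hU₀V hMU₀ hgV hV.symm hU₀n' hcomm hMc
  -- `[V : U₀] = f ≥ 2` and `[Γ : U₀] = f · [Γ : V]`
  set f : ℕ := U₀.relIndex V with hf
  have hf0 : f ≠ 0 := fun h0 =>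
    hU₀fi.index_ne_zero (Nat.eq_zero_of_zero_dvd (h0 ▸ Subgroup.relIndex_dvd_index_of_le hU₀V))
  have hf1 : f ≠ 1 := fun h1 => hg ((Subgroup.relIndex_eq_one.mp h1) hgV)
  have hidx : U₀.index = f * V.index := by rw [← Subgroup.relIndex_mul_index hU₀V]
  have hVi : 0 < V.index := Nat.pos_of_ne_zero hVfi.index_ne_zero
  -- numerics
  rw [hRF U₀ hU₀o, hRF V hVo, hM0, add_zero, hidx] at hkey
  have hnum : c * (f * V.index) + e ≤ c * V.index + e := by exact_mod_cast hkey
  have h1 : f * V.index ≤ 1 * V.index := by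
    rw [one_mul]
    exact Nat.le_of_mul_le_mul_left (Nat.le_of_add_le_add_right hnum) hc
  have h2 : f ≤ 1 := Nat.le_of_mul_le_mul_right h1 hVi
  omega

/-! ### Slimness criteria -/

/-- **Slimness from an affine rank formula.**  A profinite group `Γ` all of whose open subgroups
satisfy `δ¹_p(U) = c·[Γ:U] + e` with `c ≥ 1` is SLIM: if `g` centralises an open subgroup `U` and
`g ≠ 1`, choose an open normal `U₀ ⊴ Γ` inside `U ∖ {g}`; the commutators `g v g⁻¹ v⁻¹` (`v ∈ U₀`)
are trivial, so the core lemma (with `M = 1`) puts `g ∈ U₀` — contradiction.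
[cite: MochizukiAbsTopI2012, Thm 1.7 (ii) p.14] -/
theorem isSlimGroup_of_affine_rankFormula [CompactSpace Γ] [T2Space Γ] [TotallyDisconnectedSpace Γ]
    (p c e : ℕ) [Fact p.Prime] (hc : 0 < c)
    (hRF : ∀ U : Subgroup Γ, IsOpen (U : Set Γ) → freeProlRank U p = ((c * U.index + e : ℕ) : ℕ∞)) :
    IsSlimGroup Γ := by
  classical
  refine ⟨fun U hUo => ?_⟩
  rw [eq_bot_iff]
  intro g hg
  rw [Subgroup.mem_bot]
  by_contra hg1
  -- an open normal `U₀ ⊴ Γ` inside `U` and avoiding `g`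
  obtain ⟨W, hW⟩ := ProfiniteGrp.exist_openNormalSubgroup_sub_open_nhds_of_one
    (U := (U : Set Γ) ∩ {g}ᶜ) (hUo.inter isOpen_compl_singleton) ⟨U.one_mem, fun h => hg1 h.symm⟩
  set U₀ : Subgroup Γ := (W : Subgroup Γ) with hU₀
  haveI hU₀n : U₀.Normal := W.isNormal'
  have hU₀o : IsOpen (U₀ : Set Γ) := W.isOpen'
  have hU₀U : U₀ ≤ U := fun x hx => (hW hx).1
  have hgU₀ : g ∉ U₀ := fun h => (hW h).2 rfl
  -- `M := 1`
  have hbotc : IsClosed ((⊥ : Subgroup Γ) : Set Γ) := by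
    rw [Subgroup.coe_bot]
    exact isClosed_singleton
  have hbot0 : freeProlRank (⊥ : Subgroup Γ) p = 0 :=
    freeProlRank_eq_zero_of_forall_hom_eq_one p fun n φ x => by
      rw [Subsingleton.elim x 1, map_one]
  have hcomm : ∀ v ∈ U₀, g * v * g⁻¹ * v⁻¹ ∈ (⊥ : Subgroup Γ) := by
    intro v hv
    have hvg : v * g = g * v := Subgroup.mem_centralizer_iff.mp hg v (hU₀U hv)
    rw [Subgroup.mem_bot, ← hvg]
    group
  exact hgU₀ (mem_of_forall_commutator_mem_of_affine_rankFormula p c e hc hRF U₀ hU₀o ⊥ bot_le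
    hbotc hbot0 g hcomm)

/-- **Slimness of `Γ/K` from an affine rank formula on `Γ` and `Hom_cont(K, ℤ_pⁿ) = 1`.**  For `Γ`
profinite with `δ¹_p(U) = c·[Γ:U] + e` (`c ≥ 1`) on open subgroups and `K ⊴ Γ` closed with every
continuous homomorphism `K → ℤ_pⁿ` trivial (so `δ¹_p(K) = 0`), the quotient `Γ/K` is SLIM: if
`q = gK` centralises an open `U ⊆ Γ/K` and `q ≠ 1`, choose an open normal `W ⊴ Γ/K` inside
`U ∖ {q}` and pull it back to an open normal `U₀ ⊴ Γ` containing `K`; the commutators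
`g v g⁻¹ v⁻¹` (`v ∈ U₀`) lie in `K`, so the core lemma (with `M = K`) puts `g ∈ U₀`, i.e. `q ∈ W` —
contradiction. [cite: MochizukiAbsTopI2012, Thm 1.7 (ii) p.14] -/
theorem isSlimGroup_quotient_of_affine_rankFormula [CompactSpace Γ] [T2Space Γ]
    [TotallyDisconnectedSpace Γ] (p c e : ℕ) [Fact p.Prime] (hc : 0 < c)
    (hRF : ∀ U : Subgroup Γ, IsOpen (U : Set Γ) → freeProlRank U p = ((c * U.index + e : ℕ) : ℕ∞))
    (K : Subgroup Γ) [K.Normal] (hKc : IsClosed (K : Set Γ))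
    (hKchar : ∀ (n : ℕ) (φ : K →ₜ* Multiplicative (Fin n → ℤ_[p])), ∀ k, φ k = 1) :
    IsSlimGroup (Γ ⧸ K) := by
  classical
  haveI : IsClosed (K : Set Γ) := hKc
  haveI : TotallyDisconnectedSpace (Γ ⧸ K) := totallyDisconnectedSpace_quotient K hKc
  have hK0 : freeProlRank K p = 0 := freeProlRank_eq_zero_of_forall_hom_eq_one p hKchar
  let π : Γ →* Γ ⧸ K := QuotientGroup.mk' K
  have hπ : Function.Surjective π := QuotientGroup.mk'_surjective K
  have hπc : Continuous π := QuotientGroup.continuous_mk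
  refine ⟨fun UQ hUQo => ?_⟩
  rw [eq_bot_iff]
  intro q hq
  rw [Subgroup.mem_bot]
  by_contra hq1
  -- an open normal `W ⊴ Γ/K` inside `UQ` and avoiding `q`
  obtain ⟨W, hW⟩ := ProfiniteGrp.exist_openNormalSubgroup_sub_open_nhds_of_one
    (U := (UQ : Set (Γ ⧸ K)) ∩ {q}ᶜ) (hUQo.inter isOpen_compl_singleton)
    ⟨UQ.one_mem, fun h => hq1 h.symm⟩
  set W₀ : Subgroup (Γ ⧸ K) := (W : Subgroup (Γ ⧸ K)) with hW₀
  haveI hW₀n : W₀.Normal := W.isNormal'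
  have hW₀o : IsOpen (W₀ : Set (Γ ⧸ K)) := W.isOpen'
  have hW₀U : W₀ ≤ UQ := fun x hx => (hW hx).1
  have hqW₀ : q ∉ W₀ := fun h => (hW h).2 rfl
  -- pull back to `Γ`
  set U₀ : Subgroup Γ := W₀.comap π with hU₀
  haveI hU₀n : U₀.Normal := Subgroup.Normal.comap hW₀n π
  have hU₀o : IsOpen (U₀ : Set Γ) := hW₀o.preimage hπc
  have hKU₀ : K ≤ U₀ := by
    intro k hk
    rw [hU₀, Subgroup.mem_comap]
    have h1 : π k = 1 := (QuotientGroup.eq_one_iff k).mpr hk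
    rw [h1]
    exact W₀.one_mem
  obtain ⟨g, rfl⟩ := hπ q
  have hcomm : ∀ v ∈ U₀, g * v * g⁻¹ * v⁻¹ ∈ K := by
    intro v hv
    have hv' : π v ∈ UQ := hW₀U (Subgroup.mem_comap.mp hv)
    have hvg : π v * π g = π g * π v := Subgroup.mem_centralizer_iff.mp hq (π v) hv'
    have h1 : π (g * v * g⁻¹ * v⁻¹) = 1 := by
      rw [map_mul, map_mul, map_mul, map_inv, map_inv, ← hvg]
      group
    exact (QuotientGroup.eq_one_iff _).mp h1
  have hgU₀ : g ∈ U₀ :=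
    mem_of_forall_commutator_mem_of_affine_rankFormula p c e hc hRF U₀ hU₀o K hKU₀ hKc hK0 g hcomm
  exact hqW₀ (Subgroup.mem_comap.mp hgU₀)

/-! ### [AbsTopI] Thm 1.7 (ii): the quotient clause for `G_K`, `K/ℚ_p` finite — slimness -/

/-- The kernel `K_Σ ⊆ N ⊆ G_K` of the maximal pro-`Σ` quotient of an open `N` (membership hypothesis)
is CLOSED in `G_K` and has NO nontrivial continuous `ℤ_pⁿ`-valued characters when `p ∈ Σ` (the image
of such a character is a pro-`p`, hence pro-`Σ`, quotient of `N` dominated by `N ↠ N^Σ`; abc-iut-L4-t15's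
`padicIntPi_hom_eq_one`, transported from `K_Σ ⊆ N` to `K_Σ ⊆ G_K`).
[cite: MochizukiAbsTopI2012, Def 1.1 (iii) p.10] -/
theorem proSigmaKernel_isClosed_and_hom_eq_one (p : ℕ) [Fact p.Prime] (K : Type)
    [Field K] [Algebra ℚ_[p] K] [FiniteDimensional ℚ_[p] K] {S : Set ℕ} (hpS : p ∈ S)
    (N : Subgroup (Field.absoluteGaloisGroup K)) (hNo : IsOpen (N : Set (Field.absoluteGaloisGroup K)))
    (KS : Subgroup (Field.absoluteGaloisGroup K)) (hKSN : KS ≤ N)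
    (hKS : ∀ x : N, (x : Field.absoluteGaloisGroup K) ∈ KS ↔
      ∀ W : Subgroup N, W.Normal → IsOpen (W : Set N) → IsSigmaInteger S W.index → x ∈ W) :
    IsClosed (KS : Set (Field.absoluteGaloisGroup K)) ∧
      ∀ (n : ℕ) (φ : KS →ₜ* Multiplicative (Fin n → ℤ_[p])), ∀ k, φ k = 1 := by
  classical
  haveI : CharZero K := charZero_of_injective_algebraMap (algebraMap ℚ_[p] K).injective
  haveI : CompactSpace N := compactSpace_of_isOpen hNo
  let K' : Subgroup N := KS.subgroupOf N
  have hK' : ∀ x : N, x ∈ K' ↔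
      ∀ W : Subgroup N, W.Normal → IsOpen (W : Set N) → IsSigmaInteger S W.index → x ∈ W := by
    intro x; rw [Subgroup.mem_subgroupOf]; exact hKS x
  refine ⟨?_, ?_⟩
  · -- closed: the image of the closed `K' ⊆ N` under the closed embedding `N ↪ G_K`
    have hK'c : IsClosed (K' : Set N) := isClosed_of_mem_family hK'
    have hset : (KS : Set (Field.absoluteGaloisGroup K)) = Subtype.val '' (K' : Set N) := by
      ext x
      constructor
      · intro hx
        exact ⟨⟨x, hKSN hx⟩, Subgroup.mem_subgroupOf.mpr hx, rfl⟩
      · rintro ⟨y, hy, rfl⟩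
        exact Subgroup.mem_subgroupOf.mp hy
    rw [hset]
    exact (Subgroup.isClosed_of_isOpen N hNo).isClosedEmbedding_subtypeVal.isClosedMap _ hK'c
  · -- characters: transport along `K' → KS`
    intro n φ k
    let j : K' →ₜ* KS :=
      { toFun := fun y => ⟨((y : N) : Field.absoluteGaloisGroup K), Subgroup.mem_subgroupOf.mp y.2⟩
        map_one' := rfl
        map_mul' := fun _ _ => rfl
        continuous_toFun := (continuous_subtype_val.comp continuous_subtype_val).subtype_mk _ }
    have hk : j ⟨⟨(k : Field.absoluteGaloisGroup K), hKSN k.2⟩, Subgroup.mem_subgroupOf.mpr k.2⟩ = k :=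
      rfl
    rw [← hk]
    exact padicIntPi_hom_eq_one hK' hpS (φ.comp j) _

/-- **[AbsTopI] Thm 1.7 (ii), quotient clause (slimness) — Prop 1.6 (i) in the tree's vocabulary**:
for `K/ℚ_p` finite, an open subgroup `N ⊆ G_K`, a set of primes `Σ ∋ p`, and the kernel `K_Σ ⊆ N`
of the maximal pro-`Σ` quotient `N ↠ P` (membership: `x ∈ K_Σ ↔ x ∈ W` for every open normal
`W ⊴ N` of `Σ`-integer index), normal in `G_K` (an instance hypothesis; for `N` normal it is
discharged by `normal_of_proSigmaKernel_of_normal`), the quotient `G_K / K_Σ` — print's "almost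
pro-`p`-maximal quotient `G_k ↠ Q`" for `Σ = {p}` — is SLIM.  Route: the affine rank formula
`δ¹_p(U) = [K:ℚ_p]·[G_K:U] + 1` and `Hom_cont(K_Σ, ℤ_pⁿ) = 1` (NOT print's LCFT faithfulness
argument of Prop 1.5 (i)). [cite: MochizukiAbsTopI2012, Thm 1.7 (ii) p.14; Prop 1.6 (i) p.13] -/
theorem isSlimGroup_absoluteGaloisGroup_quotient_proSigmaKernel (p : ℕ) [Fact p.Prime] (K : Type)
    [Field K] [Algebra ℚ_[p] K] [FiniteDimensional ℚ_[p] K] {S : Set ℕ} (hpS : p ∈ S)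
    (N : Subgroup (Field.absoluteGaloisGroup K)) (hNo : IsOpen (N : Set (Field.absoluteGaloisGroup K)))
    (KS : Subgroup (Field.absoluteGaloisGroup K)) [KS.Normal] (hKSN : KS ≤ N)
    (hKS : ∀ x : N, (x : Field.absoluteGaloisGroup K) ∈ KS ↔
      ∀ W : Subgroup N, W.Normal → IsOpen (W : Set N) → IsSigmaInteger S W.index → x ∈ W) :
    IsSlimGroup (Field.absoluteGaloisGroup K ⧸ KS) := by
  classical
  haveI : CharZero K := charZero_of_injective_algebraMap (algebraMap ℚ_[p] K).injective
  obtain ⟨hKSc, hKchar⟩ := proSigmaKernel_isClosed_and_hom_eq_one p K hpS N hNo KS hKSN hKS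
  exact isSlimGroup_quotient_of_affine_rankFormula p (Module.finrank ℚ_[p] K) 1 Module.finrank_pos
    (fun U hU => freeProlRank_eq_of_isOpen_absoluteGaloisGroup p K U hU) KS hKSc hKchar

/-- **[AbsTopI] Thm 1.7 (ii), the full quotient clause**: for `K/ℚ_p` finite, `N ⊆ G_K` open,
`Σ ∋ p`, and `K_Σ ⊆ N` the kernel of the maximal pro-`Σ` quotient of `N` (membership hypothesis),
normal in `G_K`, the quotient `G_K / K_Σ` ("any almost pro-`p`-maximal quotient `G_k ↠ Q`", print
`Σ = {p}`) is ELASTIC (abc-iut-L4-t15, `isElastic_absoluteGaloisGroup_quotient_proSigmaKernel`) and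
SLIM (`isSlimGroup_absoluteGaloisGroup_quotient_proSigmaKernel`) — both by the cell's rank route.
[cite: MochizukiAbsTopI2012, Thm 1.7 (ii) p.14] -/
theorem thm17ii_quotient (p : ℕ) [Fact p.Prime] (K : Type)
    [Field K] [Algebra ℚ_[p] K] [FiniteDimensional ℚ_[p] K] {S : Set ℕ} (hpS : p ∈ S)
    (N : Subgroup (Field.absoluteGaloisGroup K)) (hNo : IsOpen (N : Set (Field.absoluteGaloisGroup K)))
    (KS : Subgroup (Field.absoluteGaloisGroup K)) [KS.Normal] (hKSN : KS ≤ N)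
    (hKS : ∀ x : N, (x : Field.absoluteGaloisGroup K) ∈ KS ↔
      ∀ W : Subgroup N, W.Normal → IsOpen (W : Set N) → IsSigmaInteger S W.index → x ∈ W) :
    IsElastic (Field.absoluteGaloisGroup K ⧸ KS) ∧ IsSlimGroup (Field.absoluteGaloisGroup K ⧸ KS) :=
  ⟨isElastic_absoluteGaloisGroup_quotient_proSigmaKernel p K hpS N hNo KS hKSN hKS,
    isSlimGroup_absoluteGaloisGroup_quotient_proSigmaKernel p K hpS N hNo KS hKSN hKS⟩

/-- **[AbsTopI] Thm 1.7 (ii), quotient clause, for a NORMAL open `N ⊴ G_K`** (print's Def 1.1 (iii):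
"for some normal open subgroup `N ⊆ G`"): then `K_Σ` is automatically normal in `G_K`
(`normal_of_proSigmaKernel_of_normal`), and `G_K / K_Σ` is elastic and slim.
[cite: MochizukiAbsTopI2012, Thm 1.7 (ii) p.14; Def 1.1 (iii) p.10] -/
theorem thm17ii_quotient_of_normal (p : ℕ) [Fact p.Prime] (K : Type)
    [Field K] [Algebra ℚ_[p] K] [FiniteDimensional ℚ_[p] K] {S : Set ℕ} (hpS : p ∈ S)
    (N : Subgroup (Field.absoluteGaloisGroup K)) [N.Normal]
    (hNo : IsOpen (N : Set (Field.absoluteGaloisGroup K)))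
    (KS : Subgroup (Field.absoluteGaloisGroup K)) (hKSN : KS ≤ N)
    (hKS : ∀ x : N, (x : Field.absoluteGaloisGroup K) ∈ KS ↔
      ∀ W : Subgroup N, W.Normal → IsOpen (W : Set N) → IsSigmaInteger S W.index → x ∈ W) :
    ∃ _ : KS.Normal,
      IsElastic (Field.absoluteGaloisGroup K ⧸ KS) ∧ IsSlimGroup (Field.absoluteGaloisGroup K ⧸ KS) :=
  haveI : KS.Normal := normal_of_proSigmaKernel_of_normal N KS hKSN hKS
  ⟨this, thm17ii_quotient p K hpS N hNo KS hKSN hKS⟩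

/-- **Slimness of `G_K` (`K/ℚ_p` finite) by the rank route** — a second proof of the `G_k` half of
[AbsTopI] Thm 1.7 (ii) / [AbsAnab] Thm 1.1.1 (ii) (the tree's proof of record is abc-iut-L4-d2's
Kummer-theoretic `galoisMLF_slim_holds`): immediate from `isSlimGroup_of_affine_rankFormula` and the
rank formula `δ¹_p(U) = [K:ℚ_p]·[G_K:U] + 1`. [cite: MochizukiAbsTopI2012, Thm 1.7 (ii) p.14] -/
theorem isSlimGroup_absoluteGaloisGroup_of_rankFormula (p : ℕ) [Fact p.Prime] (K : Type)
    [Field K] [Algebra ℚ_[p] K] [FiniteDimensional ℚ_[p] K] :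
    IsSlimGroup (Field.absoluteGaloisGroup K) := by
  haveI : CharZero K := charZero_of_injective_algebraMap (algebraMap ℚ_[p] K).injective
  exact isSlimGroup_of_affine_rankFormula p (Module.finrank ℚ_[p] K) 1 Module.finrank_pos
    (fun U hU => freeProlRank_eq_of_isOpen_absoluteGaloisGroup p K U hU)

end Literature.AnabelianGeometry.AbsoluteAnabelian

end
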